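import Summits.ABC.ABC.Theses.IsogenyGlueCongruence
import Summits.ABC.ABC.Theorems.IsogenyGlueCongruenceSemistableHeightPolyBound
import Summits.ABC.ABC.Theorems.IsogenyGlueCongruenceDegreePrimesPolyBoundedStubDiscValuation
import Literature.NumberTheory.EllipticCurves.ModularCurveManinSemistableCoprimeFormProofs
import Literature.NumberTheory.DiophantineGeometry.FaltingsHeightJInvariant
import HarnessLib

/-!
# Route `IsogenyGlueCongruence`, support item `SemistableHeightPolyBound` (stmt-ABC-13918) —
# the two heights agree for semistable curves, and what the item yields

For a globally minimal model `W/ℚ` of a SEMISTABLE elliptic curve the denominator ideal `𝔇` of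
`j = c₄³/Δ` is the whole minimal discriminant ideal `(Δ_min)` (Silverman 1986, §2: `𝔇 = Δ_{E/K}`
for semistable `E/K`, the unstable discriminant `Υ` being trivial), because a minimal equation of
a semistable curve has `gcd(c₄, Δ) = 1` (Silverman *AEC* VII.5.1, the tree's
`WeierstrassCurve.isSemistable_iff_isCoprime_c₄_Δ`). Hence the stable Faltings height
`h_F = WeierstrassCurve.stableFaltingsHeight` (closed formula with `log N(𝔇)`) and the height over
`ℚ`, `h(E/ℚ) = WeierstrassCurve.faltingsHeight` (closed formula with `log |Δ_min|`), coincide: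

* `jDenominatorIdeal_eq_span_of_isSemistable`, `absNorm_jDenominatorIdeal_eq_of_isSemistable` —
  `𝔇 = (Δ(W_{𝓞ℚ}))` and `N(𝔇) = |Δ_min|`;
* `stableFaltingsHeight_eq_faltingsHeight_of_isSemistable` — `h_F(E) = h(E/ℚ)`, the equality
  announced in the item's informal statement (the tree had only `≤`,
  `stableFaltingsHeight_le_faltingsHeight_rat`);
* `faltingsHeight_le_stableFaltingsHeight_of_isSemistable` — the comparison `h(E/ℚ) ≤ h_F(E) + 0`
  that `DegreePrimesPolyBounded.stub_discValuation_of_semistableHeightPolyBound` carried as an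
  undischarged hypothesis `hcmp`;
* `exists_log_minimalDiscriminantNorm_le_sq_of_semistableHeightPolyBound`,
  `discValuation_of_semistableHeightPolyBound` — CALIBRATION of the item: `SemistableHeightPolyBound`
  alone implies the exponential Szpiro bound `log |Δ_min(E)| ≤ C · N_E²` (and
  `v_p(Δ_min) ≤ C' N_E²`) for every semistable `E/ℚ` — a statement known in print only through
  modularity (Murty–Pasten 2013; Pasten 2024 Thm 7.5) or Baker's method (effective Shafarevich),
  which is why the item is named-fact-grade (it closes from the route items `MazurKenkuBound` and
  `ModularDatumExists`, `semistableHeightPolyBoundOfMazurKenku_proof`).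

## References

* [Silverman1986] J. H. Silverman, *Heights and elliptic curves*, in Arithmetic Geometry
  (Cornell–Silverman eds.), Springer 1986, §2 (p. 257: `(j) = 𝔄𝔇⁻¹`, `Υ_{E/K} = Δ_{E/K}𝔇⁻¹`,
  "if `E/K` is semistable then `Υ = (1)`").
* [SilvermanAEC2009] J. H. Silverman, *The Arithmetic of Elliptic Curves*, 2nd ed., VII.5
  Prop. 5.1 (semistable ⟺ `v(c₄) = 0` or `v(Δ) = 0` on a minimal equation).
-/

noncomputable section

open scoped Classical

-- `Summit.<Summit>.<Problem>` is the mandated summit-side namespace (CONVENTIONS §2); for the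
-- single-conjunct summit `ABC` the two coincide, so the duplicate `ABC.ABC` is deliberate.
set_option linter.dupNamespace false

namespace Summit.ABC.ABC.Theorems

open WeierstrassCurve NumberField IsDedekindDomain
open Summit.ABC.ABC.Theses.IsogenyGlueCongruence

/-! ### `𝔇 = (Δ_min)` for a semistable curve -/

/-- **`gcd(c₄, Δ) = 1` in `𝓞 ℚ`** for the integral model over `𝓞 ℚ` of a globally minimal model of
a semistable elliptic curve over `ℚ`: the tree's criterion `isSemistable_iff_isCoprime_c₄_Δ` for the
integral model over `ℤ`, transported along `Rat.ringOfIntegersEquiv : 𝓞 ℚ ≃+* ℤ`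
(`integralModelInt W` is by definition the transport of `W.integralModel (𝓞 ℚ)`).
[cite: SilvermanAEC2009, VII.5 Prop. 5.1] -/
theorem isCoprime_c₄_Δ_integralModel_of_isSemistable (W : WeierstrassCurve ℚ) [W.IsElliptic]
    [W.IsGloballyMinimal] (hss : W.IsSemistable ℤ) :
    IsCoprime (W.integralModel (𝓞 ℚ)).c₄ (W.integralModel (𝓞 ℚ)).Δ := by
  have h := (W.isSemistable_iff_isCoprime_c₄_Δ).mp hss
  have h4 : (integralModelInt W).c₄ = Rat.ringOfIntegersEquiv (W.integralModel (𝓞 ℚ)).c₄ := by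
    rw [integralModelInt, map_c₄]; rfl
  have hΔ : (integralModelInt W).Δ = Rat.ringOfIntegersEquiv (W.integralModel (𝓞 ℚ)).Δ := by
    rw [integralModelInt, map_Δ]; rfl
  rw [h4, hΔ] at h
  have h' : IsCoprime
      (Rat.ringOfIntegersEquiv.symm (Rat.ringOfIntegersEquiv (W.integralModel (𝓞 ℚ)).c₄))
      (Rat.ringOfIntegersEquiv.symm (Rat.ringOfIntegersEquiv (W.integralModel (𝓞 ℚ)).Δ)) :=
    h.map Rat.ringOfIntegersEquiv.symm.toRingHom
  rwa [RingEquiv.symm_apply_apply, RingEquiv.symm_apply_apply] at h'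

/-- **`𝔇 = (Δ_min)` for a semistable curve** (Silverman 1986, §2: the unstable minimal discriminant
`Υ = Δ_{E/K} 𝔇⁻¹` is `(1)` when `E/K` is semistable), over `ℚ`: for a globally minimal model `W` of
a semistable elliptic curve, the denominator ideal of `j = c₄³/Δ` is the principal ideal of `𝓞 ℚ`
generated by the discriminant of the integral model. `⊇`: `Δ · j = c₄³` is integral. `⊆`: if
`a j = b` is integral then `Δ ∣ a c₄³`, and `gcd(Δ, c₄³) = 1`
(`isCoprime_c₄_Δ_integralModel_of_isSemistable`) gives `Δ ∣ a`.
[cite: Silverman1986, §2 (p. 257)] -/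
theorem jDenominatorIdeal_eq_span_of_isSemistable (W : WeierstrassCurve ℚ) [W.IsElliptic]
    [W.IsGloballyMinimal] (hss : W.IsSemistable ℤ) :
    W.jDenominatorIdeal = Ideal.span {(W.integralModel (𝓞 ℚ)).Δ} := by
  set a₀ : 𝓞 ℚ := (W.integralModel (𝓞 ℚ)).Δ with ha₀
  set c₀ : 𝓞 ℚ := (W.integralModel (𝓞 ℚ)).c₄ with hc₀
  have haΔ : algebraMap (𝓞 ℚ) ℚ a₀ = W.Δ := integralModel_Δ_eq (𝓞 ℚ) W
  have hcc : algebraMap (𝓞 ℚ) ℚ c₀ = W.c₄ := integralModel_c₄_eq (𝓞 ℚ) W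
  have hj : W.j * W.Δ = W.c₄ ^ 3 := by
    rw [WeierstrassCurve.j, ← coe_Δ', mul_comm, ← mul_assoc, Units.mul_inv, one_mul]
  have hcop : IsCoprime c₀ a₀ := isCoprime_c₄_Δ_integralModel_of_isSemistable W hss
  apply le_antisymm
  · intro a ha
    obtain ⟨b, hb⟩ := (mem_jDenominatorIdeal W a).mp ha
    -- `a c₄³ = b Δ` in `ℚ`, hence in `𝓞 ℚ`
    have h1 : algebraMap (𝓞 ℚ) ℚ (a * c₀ ^ 3) = algebraMap (𝓞 ℚ) ℚ (b * a₀) := by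
      rw [map_mul, map_mul, map_pow, hcc, haΔ, ← hj, ← mul_assoc]
      exact congrArg (· * W.Δ) hb
    have h2 : a * c₀ ^ 3 = b * a₀ := RingOfIntegers.coe_injective h1
    have h3 : a₀ ∣ a * c₀ ^ 3 := ⟨b, by rw [h2, mul_comm]⟩
    exact Ideal.mem_span_singleton.mpr (hcop.symm.pow_right.dvd_of_dvd_mul_right h3)
  · rw [Ideal.span_singleton_le_iff_mem, mem_jDenominatorIdeal]
    refine ⟨c₀ ^ 3, ?_⟩
    show algebraMap (𝓞 ℚ) ℚ a₀ * W.j = algebraMap (𝓞 ℚ) ℚ (c₀ ^ 3)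
    rw [map_pow, hcc, haΔ, mul_comm, hj]

/-- **`N(𝔇) = |Δ_min|` for a semistable curve**: for a globally minimal model `W` of a semistable
elliptic curve over `ℚ`, the norm of the denominator ideal of `j` is the minimal discriminant norm
`W.minimalDiscriminantNorm ℤ = |Δ_min|` (`jDenominatorIdeal_eq_span_of_isSemistable`, the norm of a
principal ideal, and `minimalDiscriminantNorm_int_eq_natAbs_minimalDiscriminantInt_holds`).
[cite: Silverman1986, §2 (p. 257)] -/
theorem absNorm_jDenominatorIdeal_eq_of_isSemistable (W : WeierstrassCurve ℚ) [W.IsElliptic]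
    [W.IsGloballyMinimal] (hss : W.IsSemistable ℤ) :
    Ideal.absNorm W.jDenominatorIdeal = W.minimalDiscriminantNorm ℤ := by
  set a₀ : 𝓞 ℚ := (W.integralModel (𝓞 ℚ)).Δ with ha₀
  have haΔ : algebraMap (𝓞 ℚ) ℚ a₀ = W.Δ := integralModel_Δ_eq (𝓞 ℚ) W
  rw [jDenominatorIdeal_eq_span_of_isSemistable W hss, Ideal.absNorm_span_singleton]
  -- `N(Δ) = Δ_min`
  have hnorm : Algebra.norm ℤ a₀ = minimalDiscriminantInt W := by
    have h1 : ((Algebra.norm ℤ a₀ : ℤ) : ℚ) = (minimalDiscriminantInt W : ℚ) := by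
      have h2 := Algebra.norm_algebraMap (S := ℚ) (algebraMap (𝓞 ℚ) ℚ a₀)
      rw [Module.finrank_self, pow_one] at h2
      rw [Algebra.coe_norm_int, cast_minimalDiscriminantInt, ← haΔ]
      exact h2
    exact_mod_cast h1
  rw [hnorm, minimalDiscriminantNorm_int_eq_natAbs_minimalDiscriminantInt_holds W]

/-! ### `h_F(E) = h(E/ℚ)` for a semistable curve -/

/-- **The stable Faltings height equals the Faltings height over `ℚ` for a semistable curve.** For
a globally minimal model `W` of a semistable elliptic curve over `ℚ`,
`W.stableFaltingsHeight = W.faltingsHeight`: the two closed formulas differ by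
`(1/12)(log |Δ_min| − log N(𝔇))` (`log_unstableDiscriminant_eq_sub`), and `N(𝔇) = |Δ_min|`
(`absNorm_jDenominatorIdeal_eq_of_isSemistable`). This is Silverman's remark that for semistable
`E/K` the height over `K` is already the stable height (1986, §2 and Remark 1.2).
[cite: Silverman1986, §2 (p. 257) and Prop. 1.1] -/
theorem stableFaltingsHeight_eq_faltingsHeight_of_isSemistable (W : WeierstrassCurve ℚ)
    [W.IsElliptic] [W.IsGloballyMinimal] (hss : W.IsSemistable ℤ) :
    W.stableFaltingsHeight = W.faltingsHeight := by
  have h := Literature.NumberTheory.DiophantineGeometry.log_unstableDiscriminant_eq_sub W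
  have h1 : W.minimalDiscriminantNorm (𝓞 ℚ) = W.minimalDiscriminantNorm ℤ :=
    minimalDiscriminantNorm_ringOfIntegers_rat_holds W
  rw [Module.finrank_self, Nat.cast_one, inv_one, one_mul, h1,
    absNorm_jDenominatorIdeal_eq_of_isSemistable W hss, sub_self] at h
  linarith

/-- **`h(E/ℚ) ≤ h_F(E) + 0` for semistable globally minimal `W`** — the comparison hypothesis
`hcmp` (with `A = 0`) of
`Summit.ABC.ABC.Theorems.DegreePrimesPolyBounded.stub_discValuation_of_semistableHeightPolyBound`,
now a theorem (`stableFaltingsHeight_eq_faltingsHeight_of_isSemistable`).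
[cite: Silverman1986, §2 (p. 257)] -/
theorem faltingsHeight_le_stableFaltingsHeight_of_isSemistable (W : WeierstrassCurve ℚ)
    [W.IsElliptic] [W.IsGloballyMinimal] (hss : W.IsSemistable ℤ) :
    W.faltingsHeight ≤ W.stableFaltingsHeight + 0 := by
  rw [add_zero, stableFaltingsHeight_eq_faltingsHeight_of_isSemistable W hss]

/-! ### Calibration: the item implies exponential Szpiro for semistable curves -/

/-- **`SemistableHeightPolyBound` ⟹ `log |Δ_min(E)| ≤ C · N_E²` for every semistable `E/ℚ`.**
From `h_F(E) ≤ c N²` (the item), `h(E/ℚ) = h_F(E)`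
(`stableFaltingsHeight_eq_faltingsHeight_of_isSemistable`) and Pasten's Lemma 18.1 /
Silverman's Prop. 1.1, `log |Δ_min| < 12 h(E/ℚ) + 16` (PROVED in the tree, packaged as
`DegreePrimesPolyBounded.exists_log_minimalDiscriminantNorm_le_sq_of_faltingsHeight_le`), with
`C = max(12c + 16, 0)`. In print such a bound is known only through modularity (Murty–Pasten 2013;
Pasten 2024, Thm 7.5: `log Δ < (1/4 + ε) N log N`) or Baker's method; this theorem records that the
item is at least that strong. [cite: PastenShimura2024, Lemma 18.1 and §3] -/
theorem exists_log_minimalDiscriminantNorm_le_sq_of_semistableHeightPolyBound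
    (hH : SemistableHeightPolyBound) :
    ∃ C : ℝ, ∀ (W : WeierstrassCurve ℚ) [W.IsElliptic] [W.IsGloballyMinimal]
      [NeZero (W.conductorNorm ℤ)], W.IsSemistable ℤ →
        Real.log (W.minimalDiscriminantNorm ℤ) ≤ C * (W.conductorNorm ℤ : ℝ) ^ 2 := by
  obtain ⟨c, hc⟩ := hH
  have hc' : ∀ (W : WeierstrassCurve ℚ) [W.IsElliptic] [W.IsGloballyMinimal]
      [NeZero (W.conductorNorm ℤ)], W.IsSemistable ℤ →
        W.faltingsHeight ≤ c * (W.conductorNorm ℤ : ℝ) ^ 2 := by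
    intro W _ _ _ hss
    rw [← stableFaltingsHeight_eq_faltingsHeight_of_isSemistable W hss]
    exact hc W hss
  exact ⟨_, DegreePrimesPolyBounded.exists_log_minimalDiscriminantNorm_le_sq_of_faltingsHeight_le hc'⟩

/-- **`SemistableHeightPolyBound` ⟹ the valuation stub of crux A unconditionally**:
`v_p(Δ_min(W)) ≤ C · N_W^κ` for every semistable globally minimal elliptic `W/ℚ` and every `p`
(`DegreePrimesPolyBounded.stub_discValuation_of_semistableHeightPolyBound` with its comparison
hypothesis discharged by `faltingsHeight_le_stableFaltingsHeight_of_isSemistable`).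
[cite: Silverman1986, §2 (p. 257)] -/
theorem discValuation_of_semistableHeightPolyBound (hH : SemistableHeightPolyBound) :
    ∃ κ C : ℝ, ∀ (W : WeierstrassCurve ℚ) [W.IsElliptic] [W.IsGloballyMinimal]
      [NeZero (W.conductorNorm ℤ)], W.IsSemistable ℤ → ∀ p : ℕ,
        (((W.minimalDiscriminantNorm ℤ).factorization p : ℕ) : ℝ) ≤
          C * (W.conductorNorm ℤ : ℝ) ^ κ :=
  DegreePrimesPolyBounded.stub_discValuation_of_semistableHeightPolyBound hH (A := 0)
    (fun W _ _ hss => faltingsHeight_le_stableFaltingsHeight_of_isSemistable W hss)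

end Summit.ABC.ABC.Theorems

end
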